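import Mathlib

/-!
# Cauchy–Schwarz ("ℓ²") supply of based closed reduced colour-walks (part 1 of 3)

Helper for crux `SnSubsetDichotomy.HyperoctahedralThreshold` (stmt-MatrixMultiplication-10883), twins route;
finitary, density-free.  Parts 2–3: `…TwinSupplyCSCyclic` (word count, cyclically reduced form),
`…TwinSupplyCSPairs` (twin supply).  Permutations `μ c` (`c : Fin 3`) of a finite set `α` act on the right on
words `g : List (Fin 3)`, `x · g = g.foldl (fun v c => μ c v) x` (the skeleton's convention); REDUCED words
(`List.IsChain (· ≠ ·)`) of length `k` form `RW k`; `closedAt μ m x` = reduced `v` of length `m`, `x · v = x`.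
`supply`: for involutions `μ c` and nonempty `α`,  `|RW k|² ≤ |α|·|RW k| + ∑_{i<k} 2^i ∑_x |closedAt μ (2(k-i)) x|`:
the `|RW k|` endpoints `x · g` lie in `α`, so (Cauchy–Schwarz) the ordered pairs `(g, g')` with `x·g = x·g'`
number `≥ |RW k|²/|α|`; off the diagonal they COLLIDE; a colliding pair with different last letters gives the
closed reduced walk `g ++ g'.reverse` of length `2k` at `x` (injectively), one with equal last letters `c` comes
from the colliding pair `(g.dropLast, g'.dropLast)` with at most two `c` per shorter pair (reducedness), so
`#coll_k(x) ≤ |closedAt (2k) x| + 2·#coll_{k-1}(x)`; unroll.  Registered form: `stub_closedWalkSupply`.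
Elementary substitute for the Ihara/Kotani–Sunada count of closed non-backtracking walks.
[crux research log `Cruxes/HyperoctahedralThreshold/NOTES.md` §C1, §12.3, (15.1)]
-/

-- the tree's namespace `Summit.MatrixMultiplication.MatrixMultiplication.…` repeats a component by design
set_option linter.dupNamespace false

namespace Summit.MatrixMultiplication.MatrixMultiplication.Theorems.HyperoctahedralThreshold

namespace TwinSupplyCS

open Finset

variable {α : Type*}

/-- The right action of a colour word: `x · g = g.foldl (fun v c => μ c v) x`. -/
def act (μ : Fin 3 → Equiv.Perm α) (x : α) (g : List (Fin 3)) : α :=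
  g.foldl (fun v c => μ c v) x

/-- All colour words of length `k`, built by appending a last letter. -/
def words : ℕ → Finset (List (Fin 3))
  | 0 => {[]}
  | k + 1 => (words k).biUnion fun w => (univ : Finset (Fin 3)).image fun c => w ++ [c]

/-- The reduced colour words of length `k` (consecutive letters distinct). -/
def RW (k : ℕ) : Finset (List (Fin 3)) :=
  (words k).filter fun g => List.IsChain (· ≠ ·) g

/-- Membership in `words k` is having length `k`. -/
theorem mem_words {k : ℕ} {g : List (Fin 3)} : g ∈ words k ↔ g.length = k := by
  induction k generalizing g with
  | zero => simp [words, List.length_eq_zero_iff]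
  | succ k ih =>
    simp only [words, mem_biUnion, mem_image, mem_univ, true_and]
    constructor
    · rintro ⟨w, hw, c, rfl⟩
      simp [ih.mp hw]
    · intro hg
      have hne : g ≠ [] := by rintro rfl; simp at hg
      refine ⟨g.dropLast, ih.mpr (by simp [List.length_dropLast, hg]), g.getLast hne, ?_⟩
      exact List.dropLast_append_getLast hne

/-- Membership in `RW k`: length `k` and reduced. -/
theorem mem_RW {k : ℕ} {g : List (Fin 3)} : g ∈ RW k ↔ g.length = k ∧ List.IsChain (· ≠ ·) g := by
  simp [RW, mem_words]

/-- A word of positive length is its `dropLast` followed by its last letter. -/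
theorem exists_eq_dropLast_append {k : ℕ} {g : List (Fin 3)} (hg : g.length = k + 1) :
    ∃ c, g = g.dropLast ++ [c] ∧ g.getLast? = some c := by
  have hne : g ≠ [] := by rintro rfl; simp at hg
  exact ⟨g.getLast hne, (List.dropLast_append_getLast hne).symm, List.getLast?_eq_some_getLast hne⟩

/-- The action of a concatenation. -/
theorem act_append (μ : Fin 3 → Equiv.Perm α) (x : α) (g h : List (Fin 3)) :
    act μ x (g ++ h) = act μ (act μ x g) h := by
  simp [act, List.foldl_append]

/-- The action of a one-letter word. -/
theorem act_singleton (μ : Fin 3 → Equiv.Perm α) (x : α) (c : Fin 3) : act μ x [c] = μ c x := by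
  simp [act]

/-- For involutions, reading a word backwards undoes it: `(y · h) · h.reverse = y`. -/
theorem act_act_reverse (μ : Fin 3 → Equiv.Perm α) (hμ : ∀ c, Function.Involutive (μ c))
    (h : List (Fin 3)) (y : α) : act μ (act μ y h) h.reverse = y := by
  induction h generalizing y with
  | nil => simp [act]
  | cons c h ih =>
    have : act μ y (c :: h) = act μ (μ c y) h := by simp [act]
    rw [this, List.reverse_cons, act_append, ih, act_singleton, hμ c y]

section Dec
variable [DecidableEq α]

/-- Based closed reduced walks of length `m` at `x`: reduced words `v` of length `m` with `x · v = x`. -/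
def closedAt (μ : Fin 3 → Equiv.Perm α) (m : ℕ) (x : α) : Finset (List (Fin 3)) :=
  (RW m).filter fun v => act μ x v = x

/-- Ordered pairs of reduced words of length `k` with the same endpoint from `x`. -/
def pairsAt (μ : Fin 3 → Equiv.Perm α) (k : ℕ) (x : α) : Finset (List (Fin 3) × List (Fin 3)) :=
  (RW k ×ˢ RW k).filter fun gg => act μ x gg.1 = act μ x gg.2

/-- Colliding pairs: distinct reduced words of length `k` with the same endpoint from `x`. -/
def collAt (μ : Fin 3 → Equiv.Perm α) (k : ℕ) (x : α) : Finset (List (Fin 3) × List (Fin 3)) :=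
  (pairsAt μ k x).filter fun gg => gg.1 ≠ gg.2

/-- Membership in `closedAt`. -/
theorem mem_closedAt {μ : Fin 3 → Equiv.Perm α} {m : ℕ} {x : α} {v : List (Fin 3)} :
    v ∈ closedAt μ m x ↔ (v.length = m ∧ List.IsChain (· ≠ ·) v) ∧ act μ x v = x := by
  simp [closedAt, mem_RW]

/-- Membership in `pairsAt`. -/
theorem mem_pairsAt {μ : Fin 3 → Equiv.Perm α} {k : ℕ} {x : α} {g g' : List (Fin 3)} :
    (g, g') ∈ pairsAt μ k x ↔ (g ∈ RW k ∧ g' ∈ RW k) ∧ act μ x g = act μ x g' := by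
  simp [pairsAt]

/-- Membership in `collAt`. -/
theorem mem_collAt {μ : Fin 3 → Equiv.Perm α} {k : ℕ} {x : α} {g g' : List (Fin 3)} :
    (g, g') ∈ collAt μ k x ↔ ((g ∈ RW k ∧ g' ∈ RW k) ∧ act μ x g = act μ x g') ∧ g ≠ g' := by
  simp [collAt, pairsAt]

/-- Cauchy–Schwarz on endpoints: `|RW k|² ≤ |α| · #pairsAt`. -/
theorem sq_card_RW_le [Fintype α] (μ : Fin 3 → Equiv.Perm α) (k : ℕ) (x : α) :
    (RW k).card ^ 2 ≤ Fintype.card α * (pairsAt μ k x).card := by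
  -- fibres of the endpoint map
  set F : α → Finset (List (Fin 3)) := fun y => (RW k).filter fun g => act μ x g = y with hF
  have hW : (RW k).card = ∑ y, (F y).card :=
    card_eq_sum_card_fiberwise (f := fun g => act μ x g) (s := RW k) (t := (univ : Finset α))
      (fun _ _ => mem_univ _)
  have hP : (pairsAt μ k x).card = ∑ y, (F y).card ^ 2 := by
    have h1 : (pairsAt μ k x).card =
        ∑ y, ((pairsAt μ k x).filter fun gg => act μ x gg.1 = y).card :=
      card_eq_sum_card_fiberwise (f := fun gg : List (Fin 3) × List (Fin 3) => act μ x gg.1)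
        (t := (univ : Finset α))
        (fun _ _ => mem_univ _)
    rw [h1]
    refine sum_congr rfl fun y _ => ?_
    have h2 : ((pairsAt μ k x).filter fun gg => act μ x gg.1 = y) = F y ×ˢ F y := by
      ext ⟨g, g'⟩
      simp only [mem_filter, mem_pairsAt, hF, mem_product]
      constructor
      · rintro ⟨⟨⟨hg, hg'⟩, he⟩, hy⟩
        exact ⟨⟨hg, hy⟩, hg', by rw [← he, hy]⟩
      · rintro ⟨⟨hg, hy⟩, hg', hy'⟩
        exact ⟨⟨⟨hg, hg'⟩, by rw [hy, hy']⟩, hy⟩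
    rw [h2, card_product, sq]
  rw [hW, hP]
  simpa using (sq_sum_le_card_mul_sum_sq (s := (univ : Finset α)) (f := fun y => (F y).card))

/-- Pairs with the same endpoint = the diagonal plus the colliding pairs. -/
theorem card_pairsAt (μ : Fin 3 → Equiv.Perm α) (k : ℕ) (x : α) :
    (pairsAt μ k x).card = (RW k).card + (collAt μ k x).card := by
  have hsplit := card_filter_add_card_filter_not (s := pairsAt μ k x)
    (fun gg : List (Fin 3) × List (Fin 3) => gg.1 = gg.2)
  have hdiag : ((pairsAt μ k x).filter fun gg : List (Fin 3) × List (Fin 3) => gg.1 = gg.2) =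
      (RW k).image fun g => (g, g) := by
    ext ⟨g, g'⟩
    simp only [mem_filter, mem_pairsAt, mem_image, Prod.mk.injEq]
    constructor
    · rintro ⟨⟨⟨hg, -⟩, -⟩, rfl⟩
      exact ⟨g, hg, rfl, rfl⟩
    · rintro ⟨a, ha, rfl, rfl⟩
      exact ⟨⟨⟨ha, ha⟩, rfl⟩, rfl⟩
  have hinj : Function.Injective fun g : List (Fin 3) => (g, g) := fun a b h => by
    simpa using congrArg Prod.fst h
  rw [hdiag, card_image_of_injective _ hinj] at hsplit
  rw [← hsplit]
  rfl

/-- There are no colliding pairs of length `0`. -/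
theorem collAt_zero (μ : Fin 3 → Equiv.Perm α) (x : α) : collAt μ 0 x = ∅ := by
  ext ⟨g, g'⟩
  rw [mem_collAt, mem_RW, mem_RW]
  simp only [notMem_empty, iff_false, not_and, and_imp]
  intro hg _ hg' _ _ hne
  exact hne (by rw [List.length_eq_zero_iff.mp hg, List.length_eq_zero_iff.mp hg'])

/-- Colliding pairs whose last letters DIFFER inject into based closed reduced walks of length `2k`
via `(g, g') ↦ g ++ g'.reverse`. -/
theorem card_coll_lastNe_le (μ : Fin 3 → Equiv.Perm α) (hμ : ∀ c, Function.Involutive (μ c))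
    (k : ℕ) (x : α) :
    ((collAt μ k x).filter fun gg => gg.1.getLast? ≠ gg.2.getLast?).card ≤
      (closedAt μ (2 * k) x).card := by
  refine card_le_card_of_injOn (fun gg => gg.1 ++ gg.2.reverse) ?_ ?_
  · rintro ⟨g, g'⟩ hgg
    rw [coe_filter, Set.mem_setOf_eq, mem_collAt, mem_RW, mem_RW] at hgg
    obtain ⟨⟨⟨⟨⟨hgl, hgc⟩, hgl', hgc'⟩, he⟩, _⟩, hlast⟩ := hgg
    rw [mem_coe, mem_closedAt]
    have hlen : (g ++ g'.reverse).length = 2 * k := by simp [hgl, hgl']; ring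
    refine ⟨⟨hlen, ?_⟩, ?_⟩
    · rw [List.isChain_append]
      refine ⟨hgc, List.isChain_reverse.mpr (hgc'.imp fun a b h => Ne.symm h), ?_⟩
      intro a ha b hb hab
      rw [List.head?_reverse] at hb
      rw [Option.mem_def] at ha hb
      exact hlast (by rw [ha, hb, hab])
    · rw [act_append, he, act_act_reverse μ hμ]
  · rintro ⟨g₁, g₁'⟩ h₁ ⟨g₂, g₂'⟩ h₂ heq
    rw [coe_filter, Set.mem_setOf_eq, mem_collAt, mem_RW, mem_RW] at h₁ h₂
    have hl : g₁.length = g₂.length := by rw [h₁.1.1.1.1.1, h₂.1.1.1.1.1]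
    obtain ⟨h1, h2⟩ := List.append_inj heq hl
    exact Prod.ext h1 (List.reverse_injective h2)

/-- Colliding pairs of length `k+1` whose last letters AGREE come from colliding pairs of length `k`,
at most two per shorter pair: `(g, g') ↦ (g.dropLast, g'.dropLast)`. -/
theorem card_coll_lastEq_le (μ : Fin 3 → Equiv.Perm α) (k : ℕ) (x : α) :
    ((collAt μ (k + 1) x).filter fun gg => gg.1.getLast? = gg.2.getLast?).card ≤
      2 * (collAt μ k x).card := by
  set A := (collAt μ (k + 1) x).filter fun gg => gg.1.getLast? = gg.2.getLast? with hA
  set f : List (Fin 3) × List (Fin 3) → List (Fin 3) × List (Fin 3) :=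
    fun gg => (gg.1.dropLast, gg.2.dropLast) with hf
  -- unpack membership in `A`: lengths, reducedness, same endpoint, distinct, and a common last letter
  have memA : ∀ {g g' : List (Fin 3)}, (g, g') ∈ A →
      ∃ c, (g.length = k + 1 ∧ List.IsChain (· ≠ ·) g ∧ g = g.dropLast ++ [c]) ∧
        (g'.length = k + 1 ∧ List.IsChain (· ≠ ·) g' ∧ g' = g'.dropLast ++ [c]) ∧
        act μ x g = act μ x g' ∧ g ≠ g' := by
    intro g g' h
    rw [hA, mem_filter, mem_collAt, mem_RW, mem_RW] at h
    obtain ⟨⟨⟨⟨⟨hgl, hgc⟩, hgl', hgc'⟩, he⟩, hne⟩, hlast⟩ := h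
    obtain ⟨c, hg, hgL⟩ := exists_eq_dropLast_append hgl
    obtain ⟨c', hg', hgL'⟩ := exists_eq_dropLast_append hgl'
    have hcc : c = c' := by
      simp only at hlast
      rw [hgL, hgL'] at hlast
      exact Option.some_injective _ hlast
    subst hcc
    exact ⟨c, ⟨hgl, hgc, hg⟩, ⟨hgl', hgc', hg'⟩, he, hne⟩
  -- (1) the image lies in the colliding pairs of length `k`
  have himg : A.image f ⊆ collAt μ k x := by
    intro b hb
    obtain ⟨⟨g, g'⟩, hgg, rfl⟩ := mem_image.mp hb
    obtain ⟨c, ⟨hgl, hgc, hg⟩, ⟨hgl', hgc', hg'⟩, he, hne⟩ := memA hgg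
    simp only [hf]
    rw [mem_collAt, mem_RW, mem_RW]
    refine ⟨⟨⟨⟨by simp [List.length_dropLast, hgl], ?_⟩, by simp [List.length_dropLast, hgl'], ?_⟩,
      ?_⟩, ?_⟩
    · rw [hg] at hgc; exact (List.isChain_append.mp hgc).1
    · rw [hg'] at hgc'; exact (List.isChain_append.mp hgc').1
    · rw [hg, hg', act_append, act_append, act_singleton, act_singleton] at he
      exact (μ c).injective he
    · intro h
      exact hne (by rw [hg, hg', h])
  -- (2) each fibre has at most two elements
  have hfib : ∀ b ∈ A.image f, (A.filter fun gg => f gg = b).card ≤ 2 := by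
    rintro ⟨a, a'⟩ -
    by_cases ha : a = []
    · -- then both words are the same single letter: the fibre is empty
      have : (A.filter fun gg => f gg = (a, a')) = ∅ := by
        ext ⟨g, g'⟩
        simp only [mem_filter, notMem_empty, iff_false, not_and]
        intro hgg hfg
        obtain ⟨c, ⟨hgl, -, hg⟩, ⟨hgl', -, hg'⟩, -, hne⟩ := memA hgg
        simp only [hf, Prod.mk.injEq] at hfg
        apply hne
        have h0 : k = 0 := by
          have := congrArg List.length hfg.1
          simp only [List.length_dropLast, hgl, ha, List.length_nil] at this
          omega
        have h' : g'.dropLast = [] :=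
          List.length_eq_zero_iff.mp (by simp [List.length_dropLast, hgl', h0])
        rw [hg, hg', hfg.1, h', ha]
      rw [this, card_empty]
      exact Nat.zero_le _
    · -- the common last letter avoids `a.getLast`, by reducedness of `g = a ++ [c]`
      have hsub : (A.filter fun gg => f gg = (a, a')) ⊆
          ((univ : Finset (Fin 3)).erase (a.getLast ha)).image fun c => (a ++ [c], a' ++ [c]) := by
        rintro ⟨g, g'⟩ hgg
        rw [mem_filter] at hgg
        obtain ⟨hgg, hfg⟩ := hgg
        obtain ⟨c, ⟨-, hgc, hg⟩, ⟨-, -, hg'⟩, -, -⟩ := memA hgg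
        simp only [hf, Prod.mk.injEq] at hfg
        obtain ⟨hfa, hfa'⟩ := hfg
        refine mem_image.mpr ⟨c, ?_, ?_⟩
        · rw [mem_erase]
          refine ⟨?_, mem_univ _⟩
          rw [hg, hfa] at hgc
          have hj := (List.isChain_append.mp hgc).2.2
          intro hc
          exact hj (a.getLast ha) (List.getLast?_eq_some_getLast ha) c (by simp) hc.symm
        · rw [← hfa, ← hfa', ← hg, ← hg']
      calc (A.filter fun gg => f gg = (a, a')).card
          ≤ (((univ : Finset (Fin 3)).erase (a.getLast ha)).image
              fun c => (a ++ [c], a' ++ [c])).card := card_le_card hsub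
        _ ≤ ((univ : Finset (Fin 3)).erase (a.getLast ha)).card := card_image_le
        _ = 2 := by rw [card_erase_of_mem (mem_univ _)]; simp
  calc A.card ≤ 2 * (A.image f).card := card_le_mul_card_image A 2 hfib
    _ ≤ 2 * (collAt μ k x).card := Nat.mul_le_mul_left 2 (card_le_card himg)

/-- The last-letter recursion: `#coll_{k+1}(x) ≤ |closedAt (2(k+1)) x| + 2 · #coll_k(x)`. -/
theorem card_collAt_succ_le (μ : Fin 3 → Equiv.Perm α) (hμ : ∀ c, Function.Involutive (μ c))
    (k : ℕ) (x : α) :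
    (collAt μ (k + 1) x).card ≤ (closedAt μ (2 * (k + 1)) x).card + 2 * (collAt μ k x).card := by
  rw [← card_filter_add_card_filter_not (s := collAt μ (k + 1) x)
    (fun gg : List (Fin 3) × List (Fin 3) => gg.1.getLast? ≠ gg.2.getLast?)]
  refine Nat.add_le_add (card_coll_lastNe_le μ hμ (k + 1) x) ?_
  have : ((collAt μ (k + 1) x).filter
      fun gg : List (Fin 3) × List (Fin 3) => ¬ gg.1.getLast? ≠ gg.2.getLast?) =
      (collAt μ (k + 1) x).filter fun gg => gg.1.getLast? = gg.2.getLast? :=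
    filter_congr fun _ _ => not_not
  rw [this]
  exact card_coll_lastEq_le μ k x

/-- Unrolled: `#coll_k(x) ≤ ∑_{i<k} 2^i · |closedAt (2(k-i)) x|`. -/
theorem card_collAt_le_sum (μ : Fin 3 → Equiv.Perm α) (hμ : ∀ c, Function.Involutive (μ c))
    (k : ℕ) (x : α) :
    (collAt μ k x).card ≤ ∑ i ∈ range k, 2 ^ i * (closedAt μ (2 * (k - i)) x).card := by
  induction k with
  | zero => simp [collAt_zero]
  | succ k ih =>
    calc (collAt μ (k + 1) x).card
        ≤ (closedAt μ (2 * (k + 1)) x).card + 2 * (collAt μ k x).card := card_collAt_succ_le μ hμ k x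
      _ ≤ (closedAt μ (2 * (k + 1)) x).card +
            2 * ∑ i ∈ range k, 2 ^ i * (closedAt μ (2 * (k - i)) x).card := by gcongr
      _ = ∑ i ∈ range (k + 1), 2 ^ i * (closedAt μ (2 * (k + 1 - i)) x).card := by
          rw [sum_range_succ', mul_sum]
          have : ∀ i ∈ range k, 2 * (2 ^ i * (closedAt μ (2 * (k - i)) x).card) =
              2 ^ (i + 1) * (closedAt μ (2 * (k + 1 - (i + 1))) x).card := by
            intro i _
            rw [Nat.add_sub_add_right, pow_succ]
            ring
          rw [sum_congr rfl this]
          simp [add_comm]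

/-- **Cauchy–Schwarz supply of based closed reduced walks.**  For three involutions of a nonempty finite
set `α` and every `k`:  `|RW k|² ≤ |α|·|RW k| + ∑_{i<k} 2^i ∑_x |closedAt μ (2(k-i)) x|`. -/
theorem supply [Fintype α] [Nonempty α] (μ : Fin 3 → Equiv.Perm α)
    (hμ : ∀ c, Function.Involutive (μ c)) (k : ℕ) :
    (RW k).card ^ 2 ≤ Fintype.card α * (RW k).card +
      ∑ i ∈ range k, 2 ^ i * ∑ x : α, (closedAt μ (2 * (k - i)) x).card := by
  have hN : 0 < Fintype.card α := Fintype.card_pos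
  -- sum Cauchy–Schwarz over the base points and cancel `|α|`
  have h1 : (RW k).card ^ 2 ≤ ∑ x : α, (pairsAt μ k x).card := by
    apply Nat.le_of_mul_le_mul_left _ hN
    calc Fintype.card α * (RW k).card ^ 2 = ∑ _x : α, (RW k).card ^ 2 := by simp
      _ ≤ ∑ x : α, Fintype.card α * (pairsAt μ k x).card := sum_le_sum fun x _ => sq_card_RW_le μ k x
      _ = Fintype.card α * ∑ x : α, (pairsAt μ k x).card := by rw [mul_sum]
  calc (RW k).card ^ 2 ≤ ∑ x : α, (pairsAt μ k x).card := h1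
    _ = ∑ x : α, ((RW k).card + (collAt μ k x).card) := sum_congr rfl fun x _ => card_pairsAt μ k x
    _ = Fintype.card α * (RW k).card + ∑ x : α, (collAt μ k x).card := by
        rw [sum_add_distrib]; simp
    _ ≤ Fintype.card α * (RW k).card +
          ∑ x : α, ∑ i ∈ range k, 2 ^ i * (closedAt μ (2 * (k - i)) x).card := by
        gcongr with x
        exact card_collAt_le_sum μ hμ k x
    _ = Fintype.card α * (RW k).card +
          ∑ i ∈ range k, 2 ^ i * ∑ x : α, (closedAt μ (2 * (k - i)) x).card := by
        rw [sum_comm]; simp [mul_sum]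

/-- The based closed reduced walks of length `m`, as a finset of pairs `(x, v)`, are counted by
`∑_x |closedAt μ m x|`. -/
theorem sum_card_closedAt [Fintype α] (μ : Fin 3 → Equiv.Perm α) (m : ℕ) :
    ∑ x : α, (closedAt μ m x).card =
      (((univ : Finset α) ×ˢ RW m).filter fun xv => act μ xv.1 xv.2 = xv.1).card := by
  rw [card_eq_sum_card_fiberwise (f := fun xv : α × List (Fin 3) => xv.1) (t := (univ : Finset α))
    (fun _ _ => mem_univ _)]
  refine sum_congr rfl fun x _ => ?_
  have : ((((univ : Finset α) ×ˢ RW m).filter fun xv => act μ xv.1 xv.2 = xv.1).filter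
      fun xv : α × List (Fin 3) => xv.1 = x) = (closedAt μ m x).map ⟨Prod.mk x, Prod.mk_right_injective x⟩ := by
    ext ⟨y, v⟩
    simp only [mem_filter, mem_product, mem_univ, true_and, mem_map, Function.Embedding.coeFn_mk,
      Prod.mk.injEq, mem_closedAt, mem_RW]
    constructor
    · rintro ⟨⟨hv, hy⟩, rfl⟩
      exact ⟨v, ⟨hv, hy⟩, rfl, rfl⟩
    · rintro ⟨w, ⟨hw, hx⟩, rfl, rfl⟩
      exact ⟨⟨hw, hx⟩, rfl⟩
  rw [this, card_map]

end Dec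

/-! ### Registered form on `Fin n` (tree vocabulary: `List.Vector` word finsets, raw `foldl`) -/

/-- `RW m` in the tree's vocabulary: lists of vectors of length `m`, filtered by reducedness. -/
theorem RW_eq_vector (m : ℕ) : RW m =
    ((univ : Finset (List.Vector (Fin 3) m)).image (fun v => v.toList)).filter
      (fun g => List.IsChain (· ≠ ·) g) := by
  ext g
  simp only [mem_RW, mem_filter, mem_image, mem_univ, true_and]
  constructor
  · rintro ⟨hl, hc⟩
    exact ⟨⟨⟨g, hl⟩, rfl⟩, hc⟩
  · rintro ⟨⟨v, rfl⟩, hc⟩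
    exact ⟨v.toList_length, hc⟩

/-- `μ c * μ c = 1` as pointwise involutivity. -/
theorem involutive_of_mul_self {n : ℕ} (μ : Fin 3 → Equiv.Perm (Fin n)) (hμ : ∀ c, μ c * μ c = 1)
    (c : Fin 3) : Function.Involutive (μ c) := fun v => by
  simpa [Equiv.Perm.mul_apply] using Equiv.ext_iff.mp (hμ c) v

/-- **`stub_closedWalkSupply`** (registered sub-goal of stmt-MatrixMultiplication-10883): the closed-walk supply
on `Fin n` with the word count left symbolic — `W_k² ≤ n·W_k + ∑_{i<k} 2^i·#{(x, v) : v reduced, |v| = 2(k-i),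
x·v = x}`, `W_k = #(reduced words of length k)`. -/
theorem stub_closedWalkSupply : ∀ (n k : ℕ) (μ : Fin 3 → Equiv.Perm (Fin n)), (∀ c, μ c * μ c = 1) → 1 ≤ n → (((Finset.univ : Finset (List.Vector (Fin 3) k)).image (fun v => v.toList)).filter (fun g => List.IsChain (· ≠ ·) g)).card ^ 2 ≤ n * (((Finset.univ : Finset (List.Vector (Fin 3) k)).image (fun v => v.toList)).filter (fun g => List.IsChain (· ≠ ·) g)).card + ∑ i ∈ Finset.range k, 2 ^ i * (((Finset.univ : Finset (Fin n)) ×ˢ (((Finset.univ : Finset (List.Vector (Fin 3) (2 * (k - i)))).image (fun v => v.toList)).filter (fun g => List.IsChain (· ≠ ·) g))).filter (fun p => p.2.foldl (fun v c => μ c v) p.1 = p.1)).card := by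
  intro n k μ hμ hn
  haveI : Nonempty (Fin n) := ⟨⟨0, hn⟩⟩
  have h := supply μ (involutive_of_mul_self μ hμ) k
  rw [Fintype.card_fin, RW_eq_vector] at h
  refine h.trans (Nat.add_le_add_left (le_of_eq ?_) _)
  refine sum_congr rfl fun i _ => ?_
  rw [sum_card_closedAt, RW_eq_vector]
  rfl
end TwinSupplyCS

end Summit.MatrixMultiplication.MatrixMultiplication.Theorems.HyperoctahedralThreshold
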